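import Summits.QuantumAdvantage.QuantumAdvantage.Theorems.ClassicalReplicaB1
import HarnessLib

/-!
# Classical replica coupling (B2) — decomp-qadv lens-3 («MagnitudeDial» line), generation 29, part 3/3

**Theorem `moment_le`:** in the model of part A, for every randomized adaptive classical query
algorithm `A : σ → Strategy N` whose query marginals are `λ`-light at all levels `ℓ ≤ T`
(`cnt A ℓ j ≤ λ |σ| 2^N`), and every `m ≥ 1`,
`moment A T m ≤ λ^{m-1} · ∏_{i ∈ range m} (1 + i·T²) · |σ|^m · 2^N`,
where `moment A T m = Σ_y Σ_j n_y(j)^m`, `n_y(j) = nS A T y j = #{s : pos (A s) y T = j}`;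
i.e. `E_y Σ_j p_y(j)^m ≤ λ^{m-1} ∏_{i<m} (1 + i T²)` (CLASSICAL-HBR.md, Theorem 1, of the node
record `run/shared/lean/pub/decomp-qadv/decomp-qadv-lens-3/g29/`).  By Markov in `m` this gives the
exponential tail `P_y[max_j p_y(j) ≥ f] ≤ (e²/f) exp(-(f/λ)/(e(1+T²)))` (paper, Corollary 2 there).

Proof: `moment_one` (`= |σ| 2^N`) and the induction step
`moment_succ_le : moment A T (m+1) ≤ λ|σ|(1 + m T²) · moment A T m`, by the GROUP coupling:
`n^m = Σ_{v : Fin m → σ} ∏_i 1[pos_{v i} = j]` (`pow_nS_eq_sum_agreeV`, `Fintype.prod_sum`); the `m`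
old replicas share the source `yA` (revealed set `readSetV` = union of their read sets, `≤ m T`
positions, stable under gluing), so ANY such gluing is an involution of `Oracle × Oracle`
(`PhiR_involutive`, `sum_glueR`); the old replicas run on the glued oracle as on `yA`
(`pos_glueV_old`), the new replica runs as its free run on `yB` unless it attaches
(`pos_glueV_new`); the free term is `≤ L · Σ_j agreeV` by final-level lightness
(`sum_cnt_final_le`, `L = λ|σ|2^N`) and the attachment term is `≤ T · mT · L` (`sum_attach_le`).

This file (B2): `sum_cnt_final_le`, `sum_attach_le`, `moment_succ_le`, `moment_le` (B1 has the coupling lemmas).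
-/

set_option linter.dupNamespace false

namespace Summit.QuantumAdvantage.QuantumAdvantage.Theorems.ClassicalReplica

open Finset

variable {N : ℕ} {σ : Type} [Fintype σ]

section Replicas

variable (A : σ → Strategy N) (T : ℕ)

/-- `Σ_j n_y(j)·(indicator) ≤ …`: the final-level lightness in the form used below. -/
theorem sum_cnt_final_le (lam : ℝ)
    (hlight : ∀ ℓ ≤ T, ∀ j : Fin N, cnt A ℓ j ≤ lam * Fintype.card σ * 2 ^ N)
    {m : ℕ} (v : Fin m → σ) (yA : Oracle N) :
    ∑ s : σ, ∑ yB : Oracle N, ∑ j : Fin N,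
        agreeV A T v yA j * (if pos (A s) yB T = j then (1:ℝ) else 0)
      ≤ (lam * Fintype.card σ * 2 ^ N) * ∑ j : Fin N, agreeV A T v yA j := by
  calc ∑ s : σ, ∑ yB : Oracle N, ∑ j : Fin N,
        agreeV A T v yA j * (if pos (A s) yB T = j then (1:ℝ) else 0)
      = ∑ s : σ, ∑ j : Fin N, ∑ yB : Oracle N,
        agreeV A T v yA j * (if pos (A s) yB T = j then (1:ℝ) else 0) :=
        Finset.sum_congr rfl fun s _ => Finset.sum_comm
    _ = ∑ j : Fin N, ∑ s : σ, ∑ yB : Oracle N,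
        agreeV A T v yA j * (if pos (A s) yB T = j then (1:ℝ) else 0) := Finset.sum_comm
    _ = ∑ j : Fin N, agreeV A T v yA j * cnt A T j := by
        refine Finset.sum_congr rfl fun j _ => ?_
        unfold cnt
        rw [Finset.mul_sum]
        refine Finset.sum_congr rfl fun s _ => ?_
        rw [Finset.mul_sum]
    _ ≤ ∑ j : Fin N, agreeV A T v yA j * (lam * Fintype.card σ * 2 ^ N) :=
        Finset.sum_le_sum fun j _ =>
          mul_le_mul_of_nonneg_left (hlight T le_rfl j) (agreeV_nonneg A T v yA j)
    _ = (lam * Fintype.card σ * 2 ^ N) * ∑ j : Fin N, agreeV A T v yA j := by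
        rw [Finset.mul_sum]
        exact Finset.sum_congr rfl fun j _ => mul_comm _ _

/-- The attachment count for a tuple's revealed set. -/
theorem sum_attach_le (lam : ℝ) (hlam : 0 ≤ lam)
    (hlight : ∀ ℓ ≤ T, ∀ j : Fin N, cnt A ℓ j ≤ lam * Fintype.card σ * 2 ^ N)
    {m : ℕ} (v : Fin m → σ) (yA : Oracle N) :
    ∑ s : σ, ∑ yB : Oracle N, ∑ i ∈ Finset.range T,
        (if pos (A s) yB i ∈ readSetV A T v yA then (1:ℝ) else 0)
      ≤ T * ((m * T : ℝ) * (lam * Fintype.card σ * 2 ^ N)) := by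
  set L : ℝ := lam * Fintype.card σ * 2 ^ N with hL_def
  have hLnn : 0 ≤ L := by rw [hL_def]; positivity
  have hone : ∀ i < T, ∑ s : σ, ∑ yB : Oracle N,
      (if pos (A s) yB i ∈ readSetV A T v yA then (1:ℝ) else 0) ≤ (m * T : ℝ) * L := by
    intro i hi
    have hrw : ∀ (s : σ) (yB : Oracle N),
        (if pos (A s) yB i ∈ readSetV A T v yA then (1:ℝ) else 0)
          = ∑ j ∈ readSetV A T v yA, (if pos (A s) yB i = j then (1:ℝ) else 0) :=
      fun s yB => (Finset.sum_ite_eq (readSetV A T v yA) (pos (A s) yB i) fun _ => (1:ℝ)).symm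
    calc ∑ s : σ, ∑ yB : Oracle N,
          (if pos (A s) yB i ∈ readSetV A T v yA then (1:ℝ) else 0)
        = ∑ s : σ, ∑ yB : Oracle N, ∑ j ∈ readSetV A T v yA,
            (if pos (A s) yB i = j then (1:ℝ) else 0) := by simp only [hrw]
      _ = ∑ s : σ, ∑ j ∈ readSetV A T v yA, ∑ yB : Oracle N,
            (if pos (A s) yB i = j then (1:ℝ) else 0) :=
          Finset.sum_congr rfl fun s _ => Finset.sum_comm
      _ = ∑ j ∈ readSetV A T v yA, cnt A i j := by
          unfold cnt
          exact Finset.sum_comm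
      _ ≤ ∑ j ∈ readSetV A T v yA, L := Finset.sum_le_sum fun j _ => hlight i hi.le j
      _ = (readSetV A T v yA).card * L := by rw [Finset.sum_const, nsmul_eq_mul]
      _ ≤ (m * T : ℝ) * L := by
          have hc : ((readSetV A T v yA).card : ℝ) ≤ m * T := by
            exact_mod_cast card_readSetV_le A T v yA
          exact mul_le_mul_of_nonneg_right hc hLnn
  calc ∑ s : σ, ∑ yB : Oracle N, ∑ i ∈ Finset.range T,
        (if pos (A s) yB i ∈ readSetV A T v yA then (1:ℝ) else 0)
      = ∑ s : σ, ∑ i ∈ Finset.range T, ∑ yB : Oracle N,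
        (if pos (A s) yB i ∈ readSetV A T v yA then (1:ℝ) else 0) :=
        Finset.sum_congr rfl fun s _ => Finset.sum_comm
    _ = ∑ i ∈ Finset.range T, ∑ s : σ, ∑ yB : Oracle N,
        (if pos (A s) yB i ∈ readSetV A T v yA then (1:ℝ) else 0) := Finset.sum_comm
    _ ≤ ∑ i ∈ Finset.range T, (m * T : ℝ) * L :=
        Finset.sum_le_sum fun i hi => hone i (Finset.mem_range.1 hi)
    _ = T * ((m * T : ℝ) * L) := by rw [Finset.sum_const, Finset.card_range, nsmul_eq_mul]

/-- **Induction step:** `moment (m+1) ≤ λ |σ| (1 + m T²) · moment m`. -/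
theorem moment_succ_le (lam : ℝ) (hlam : 0 ≤ lam)
    (hlight : ∀ ℓ ≤ T, ∀ j : Fin N, cnt A ℓ j ≤ lam * Fintype.card σ * 2 ^ N) (m : ℕ) :
    moment A T (m + 1) ≤ lam * Fintype.card σ * (1 + m * (T : ℝ) ^ 2) * moment A T m := by
  classical
  set L : ℝ := lam * Fintype.card σ * 2 ^ N with hL_def
  have hLnn : 0 ≤ L := by rw [hL_def]; positivity
  -- (0) expand `n^(m+1) = n^m · n` into tuples and a new seed
  have hexp : moment A T (m + 1)
      = ∑ v : Fin m → σ, ∑ s : σ, ∑ y : Oracle N, ∑ j : Fin N,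
          agreeV A T v y j * (if pos (A s) y T = j then (1:ℝ) else 0) := by
    unfold moment
    calc ∑ y : Oracle N, ∑ j : Fin N, nS A T y j ^ (m + 1)
        = ∑ y : Oracle N, ∑ j : Fin N, ∑ v : Fin m → σ, ∑ s : σ,
            agreeV A T v y j * (if pos (A s) y T = j then (1:ℝ) else 0) := by
          refine Finset.sum_congr rfl fun y _ => Finset.sum_congr rfl fun j _ => ?_
          rw [pow_succ, pow_nS_eq_sum_agreeV, Finset.sum_mul]
          refine Finset.sum_congr rfl fun v _ => ?_
          unfold nS
          rw [Finset.mul_sum]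
      _ = ∑ y : Oracle N, ∑ v : Fin m → σ, ∑ j : Fin N, ∑ s : σ,
            agreeV A T v y j * (if pos (A s) y T = j then (1:ℝ) else 0) :=
          Finset.sum_congr rfl fun y _ => Finset.sum_comm
      _ = ∑ v : Fin m → σ, ∑ y : Oracle N, ∑ j : Fin N, ∑ s : σ,
            agreeV A T v y j * (if pos (A s) y T = j then (1:ℝ) else 0) := Finset.sum_comm
      _ = ∑ v : Fin m → σ, ∑ y : Oracle N, ∑ s : σ, ∑ j : Fin N,
            agreeV A T v y j * (if pos (A s) y T = j then (1:ℝ) else 0) :=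
          Finset.sum_congr rfl fun v _ => Finset.sum_congr rfl fun y _ => Finset.sum_comm
      _ = ∑ v : Fin m → σ, ∑ s : σ, ∑ y : Oracle N, ∑ j : Fin N,
            agreeV A T v y j * (if pos (A s) y T = j then (1:ℝ) else 0) :=
          Finset.sum_congr rfl fun v _ => Finset.sum_comm
  -- (1) pointwise bound on the glued oracle
  have hpt : ∀ (v : Fin m → σ) (s : σ) (yA yB : Oracle N),
      ∑ j : Fin N, agreeV A T v (glueV A T v yA yB) j
          * (if pos (A s) (glueV A T v yA yB) T = j then (1:ℝ) else 0)
        ≤ ∑ j : Fin N, agreeV A T v yA j * (if pos (A s) yB T = j then (1:ℝ) else 0)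
          + (∑ j : Fin N, agreeV A T v yA j)
            * ∑ i ∈ Finset.range T,
                (if pos (A s) yB i ∈ readSetV A T v yA then (1:ℝ) else 0) := by
    intro v s yA yB
    have hagree : ∀ j : Fin N, agreeV A T v (glueV A T v yA yB) j = agreeV A T v yA j := by
      intro j
      unfold agreeV
      refine Finset.prod_congr rfl fun i _ => ?_
      rw [pos_glueV_old A T v yA yB i le_rfl]
    simp only [hagree]
    have hatt_nonneg : 0 ≤ ∑ i ∈ Finset.range T,
        (if pos (A s) yB i ∈ readSetV A T v yA then (1:ℝ) else 0) :=
      Finset.sum_nonneg fun i _ => by split_ifs <;> norm_num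
    have hsumA_nonneg : 0 ≤ ∑ j : Fin N, agreeV A T v yA j :=
      Finset.sum_nonneg fun j _ => agreeV_nonneg A T v yA j
    by_cases hatt : ∃ i < T, pos (A s) yB i ∈ readSetV A T v yA
    · obtain ⟨i, hi, hmem⟩ := hatt
      have h1 : (1:ℝ) ≤ ∑ i ∈ Finset.range T,
          (if pos (A s) yB i ∈ readSetV A T v yA then (1:ℝ) else 0) := by
        have := Finset.single_le_sum
          (f := fun i => (if pos (A s) yB i ∈ readSetV A T v yA then (1:ℝ) else 0))
          (fun i _ => by
            show (0:ℝ) ≤ (if pos (A s) yB i ∈ readSetV A T v yA then (1:ℝ) else 0)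
            split_ifs <;> norm_num)
          (Finset.mem_range.2 hi)
        simpa [hmem] using this
      -- the left side is ≤ Σ_j agreeV ≤ (Σ_j agreeV) · attach
      have hl : ∑ j : Fin N, agreeV A T v yA j
            * (if pos (A s) (glueV A T v yA yB) T = j then (1:ℝ) else 0)
          ≤ ∑ j : Fin N, agreeV A T v yA j :=
        Finset.sum_le_sum fun j _ => by
          have ha := agreeV_nonneg A T v yA j
          have : (if pos (A s) (glueV A T v yA yB) T = j then (1:ℝ) else 0) ≤ 1 := by
            split_ifs <;> norm_num
          nlinarith
      have hr : 0 ≤ ∑ j : Fin N, agreeV A T v yA j * (if pos (A s) yB T = j then (1:ℝ) else 0) :=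
        Finset.sum_nonneg fun j _ => mul_nonneg (agreeV_nonneg A T v yA j)
          (by split_ifs <;> norm_num)
      nlinarith
    · push Not at hatt
      rw [pos_glueV_new A T v (A s) yA yB hatt]
      nlinarith
  -- (2) coupling identity + summation
  have hkey : (2:ℝ) ^ N * moment A T (m + 1)
      = ∑ v : Fin m → σ, ∑ s : σ, ∑ yA : Oracle N, ∑ yB : Oracle N, ∑ j : Fin N,
          agreeV A T v (glueV A T v yA yB) j
            * (if pos (A s) (glueV A T v yA yB) T = j then (1:ℝ) else 0) := by
    rw [hexp, Finset.mul_sum]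
    refine Finset.sum_congr rfl fun v _ => ?_
    rw [Finset.mul_sum]
    refine Finset.sum_congr rfl fun s _ => ?_
    exact (sum_glueV A T v (fun y => ∑ j : Fin N,
      agreeV A T v y j * (if pos (A s) y T = j then (1:ℝ) else 0))).symm
  have hv : ∀ v : Fin m → σ,
      ∑ s : σ, ∑ yA : Oracle N, ∑ yB : Oracle N, ∑ j : Fin N,
          agreeV A T v (glueV A T v yA yB) j
            * (if pos (A s) (glueV A T v yA yB) T = j then (1:ℝ) else 0)
        ≤ (L * (1 + m * (T : ℝ) ^ 2)) * ∑ yA : Oracle N, ∑ j : Fin N, agreeV A T v yA j := by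
    intro v
    calc ∑ s : σ, ∑ yA : Oracle N, ∑ yB : Oracle N, ∑ j : Fin N,
          agreeV A T v (glueV A T v yA yB) j
            * (if pos (A s) (glueV A T v yA yB) T = j then (1:ℝ) else 0)
        = ∑ yA : Oracle N, ∑ s : σ, ∑ yB : Oracle N, ∑ j : Fin N,
          agreeV A T v (glueV A T v yA yB) j
            * (if pos (A s) (glueV A T v yA yB) T = j then (1:ℝ) else 0) := Finset.sum_comm
      _ ≤ ∑ yA : Oracle N, ∑ s : σ, ∑ yB : Oracle N,
          (∑ j : Fin N, agreeV A T v yA j * (if pos (A s) yB T = j then (1:ℝ) else 0)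
            + (∑ j : Fin N, agreeV A T v yA j)
              * ∑ i ∈ Finset.range T,
                  (if pos (A s) yB i ∈ readSetV A T v yA then (1:ℝ) else 0)) :=
          Finset.sum_le_sum fun yA _ => Finset.sum_le_sum fun s _ =>
            Finset.sum_le_sum fun yB _ => hpt v s yA yB
      _ = ∑ yA : Oracle N,
          ((∑ s : σ, ∑ yB : Oracle N, ∑ j : Fin N,
              agreeV A T v yA j * (if pos (A s) yB T = j then (1:ℝ) else 0))
            + (∑ j : Fin N, agreeV A T v yA j)
              * ∑ s : σ, ∑ yB : Oracle N, ∑ i ∈ Finset.range T,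
                  (if pos (A s) yB i ∈ readSetV A T v yA then (1:ℝ) else 0)) := by
          refine Finset.sum_congr rfl fun yA _ => ?_
          simp only [Finset.sum_add_distrib, Finset.mul_sum]
      _ ≤ ∑ yA : Oracle N,
          (L * ∑ j : Fin N, agreeV A T v yA j
            + (∑ j : Fin N, agreeV A T v yA j) * (T * ((m * T : ℝ) * L))) :=
          Finset.sum_le_sum fun yA _ => add_le_add (sum_cnt_final_le A T lam hlight v yA)
            (mul_le_mul_of_nonneg_left (sum_attach_le A T lam hlam hlight v yA)
              (Finset.sum_nonneg fun j _ => agreeV_nonneg A T v yA j))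
      _ = (L * (1 + m * (T : ℝ) ^ 2)) * ∑ yA : Oracle N, ∑ j : Fin N, agreeV A T v yA j := by
          rw [Finset.mul_sum]
          exact Finset.sum_congr rfl fun yA _ => by ring
  have htot : (2:ℝ) ^ N * moment A T (m + 1)
      ≤ (L * (1 + m * (T : ℝ) ^ 2)) * moment A T m := by
    rw [hkey, moment_eq_sum_agreeV, Finset.mul_sum]
    exact Finset.sum_le_sum fun v _ => hv v
  have h2N : (0:ℝ) < 2 ^ N := by positivity
  have : (2:ℝ) ^ N * moment A T (m + 1)
      ≤ (2:ℝ) ^ N * (lam * Fintype.card σ * (1 + m * (T : ℝ) ^ 2) * moment A T m) := by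
    calc (2:ℝ) ^ N * moment A T (m + 1) ≤ (L * (1 + m * (T : ℝ) ^ 2)) * moment A T m := htot
      _ = (2:ℝ) ^ N * (lam * Fintype.card σ * (1 + m * (T : ℝ) ^ 2) * moment A T m) := by
          rw [hL_def]; ring
  exact le_of_mul_le_mul_left this h2N

/-- **Replica-moment bound** (CLASSICAL-HBR.md, Theorem 1): for every `m ≥ 1`,
`Σ_y Σ_j n_y(j)^m ≤ λ^{m-1} · ∏_{i<m} (1 + i T²) · |σ|^m · 2^N`, i.e.
`E_y Σ_j p_y(j)^m ≤ λ^{m-1} ∏_{i<m} (1 + i T²)`, for every classical randomized adaptive query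
algorithm whose query marginals are `≤ λ` (T = number of revealed queries). -/
theorem moment_le (lam : ℝ) (hlam : 0 ≤ lam)
    (hlight : ∀ ℓ ≤ T, ∀ j : Fin N, cnt A ℓ j ≤ lam * Fintype.card σ * 2 ^ N) :
    ∀ m : ℕ, 1 ≤ m → moment A T m
      ≤ lam ^ (m - 1) * (∏ i ∈ Finset.range m, (1 + (i : ℝ) * (T : ℝ) ^ 2))
        * (Fintype.card σ : ℝ) ^ m * 2 ^ N := by
  intro m hm
  induction m, hm using Nat.le_induction with
  | base =>
      rw [moment_one]
      simp
  | succ m hm ih =>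
      have hstep := moment_succ_le A T lam hlam hlight m
      have hfac : 0 ≤ lam * Fintype.card σ * (1 + m * (T : ℝ) ^ 2) := by positivity
      calc moment A T (m + 1)
          ≤ lam * Fintype.card σ * (1 + m * (T : ℝ) ^ 2) * moment A T m := hstep
        _ ≤ lam * Fintype.card σ * (1 + m * (T : ℝ) ^ 2)
            * (lam ^ (m - 1) * (∏ i ∈ Finset.range m, (1 + (i : ℝ) * (T : ℝ) ^ 2))
              * (Fintype.card σ : ℝ) ^ m * 2 ^ N) := mul_le_mul_of_nonneg_left ih hfac
        _ = lam ^ (m + 1 - 1) * (∏ i ∈ Finset.range (m + 1), (1 + (i : ℝ) * (T : ℝ) ^ 2))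
            * (Fintype.card σ : ℝ) ^ (m + 1) * 2 ^ N := by
          rw [Finset.prod_range_succ, show m + 1 - 1 = (m - 1) + 1 by omega, pow_succ, pow_succ]
          ring

end Replicas

end Summit.QuantumAdvantage.QuantumAdvantage.Theorems.ClassicalReplica
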